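import Summits.CriticalPhenomena.CardyFormulaZ2.Theorems.CardyIKTransportIKMixedBoxCrossingTransportVerticalClause
import Summits.CriticalPhenomena.CardyFormulaZ2.Theorems.CardyIKTransportIKMixedBoxCrossingDefectGlueColDefs
import Summits.CriticalPhenomena.CardyFormulaZ2.Theorems.CardyIKTransportIKMixedBoxCrossingStubMonotone

/-!
# `CardyIKTransport.IKLinearTransport` (stmt-CriticalPhenomena-5076) — first LANDED fragments of the sub-crux `IKFarRSW`
# (line `pinned-diagram-exchange`, skeleton v23 stub `stub_IKFarRSW`), imported from the sister line of stmt-5911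

`stub_IKFarRSW` (= the proposed route child `IKFarRSW`) asks, for every aspect bound `k`, every column pattern `S` and every
`w × h` box with `n ≤ w, h ≤ k n`: black left–right crossing, black bottom–top crossing and a black ring, each with
`ν_S`-probability `≥ c_k`. The line `defect-closure-exploration` of the r4 crux `IKMixedBoxCrossing` (stmt-5911) has LANDED
(p138511, `…IKMixedBoxCrossingTransportVerticalClause.lean`) the Yang–Baxter monotone transport giving the VERTICAL 2:1 clause for
EVERY pattern (`verticalClause`) and, through the quarter turn, RSW for the isotropic model (`PureIKBoxCrossing`). This file
re-expresses those two theorems in THIS line's vocabulary (`νmix`, `lrCross`, `tbCross`) — the observable law evaluates crossing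
events as the gauge does (`nuMix_real_tbCross`, `nuMix_real_lrCross`), and the `2n × n` horizontal probability is the free-model
one through `pLR_two_mul_eq_pH` + `GaugeBridge` — so that the prover of `IKFarRSW` starts from:
* `ikFarRSW_tbCross_two` — the bottom–top clause at aspect 2 (`n × 2n` boxes), uniformly in `S` and in the position;
* `ikFarRSW_lrCross_two_iso` — the left–right clause at aspect 2 (`2n × n` boxes) for every box whose interior face columns are
  isotropic, uniformly in `S` and in the position.
What remains of `IKFarRSW` after these: the horizontal clause for mixed boxes (stmt-5911's last sorry `stub_csmColIneq`), all
aspect ratios `k > 2`, and the rings — the FKG-free gluing (line report c6 §2).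
-/

noncomputable section

namespace Summit.CriticalPhenomena.CardyFormulaZ2.Theorems.IKLinearTransport.PinnedDiagramExchange.FarRSWFragments

open Summit.CriticalPhenomena.CardyFormulaZ2.Theorems.IKLinearTransport.PinnedDiagramExchange
open Summit.CriticalPhenomena.CardyFormulaZ2.Cruxes.IKMixedBoxCrossing.PairedMirrorExploration
open Summit.CriticalPhenomena.CardyFormulaZ2.Cruxes.IKMixedBoxCrossing.DefectClosureExploration
open MeasureTheory

/-- **Bottom–top clause of `IKFarRSW` at aspect 2, every pattern** (registered sub-goal `ikFarRSW_tbCross_two`): there is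
`c > 0` such that for every column pattern `S`, every `n ≥ 1` and every position `(a, b)`, the `n × 2n` cell box is crossed
bottom-to-top by a black path with `ν_S`-probability at least `c` — the sister line's `verticalClause` (Yang–Baxter monotone
transport, p138511) read through `nuMix_real_tbCross`. -/
theorem ikFarRSW_tbCross_two :
    ∃ c : ℝ, 0 < c ∧ ∀ (S : Set ℤ) (n : ℕ) (a b : ℤ), 1 ≤ n → c ≤ (νmix S).real (tbCross a b n (2 * n)) := by
  obtain ⟨c, hc, h⟩ := verticalClause
  refine ⟨c, hc, fun S n a b hn => ?_⟩
  rw [nuMix_real_tbCross]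
  exact h S n a b hn

/-- **Left–right clause of `IKFarRSW` at aspect 2 on isotropic boxes, every pattern** (registered sub-goal
`ikFarRSW_lrCross_two_iso`): there is `c > 0` such that for every column pattern `S`, every `n ≥ 1` and every position
`(a, b)` whose box `[a, a + 2n) × [b, b + n)` has all its interior face columns isotropic (`x ∈ S` for `a ≤ x`, `x + 1 < a + 2n`),
the box is crossed left-to-right by a black path with `ν_S`-probability at least `c` — the sister line's `PureIKBoxCrossing`
(vertical clause + quarter turn, p138511) read through `nuMix_real_lrCross`, `pLR_two_mul_eq_pH` and the gauge bridge. -/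
theorem ikFarRSW_lrCross_two_iso :
    ∃ c : ℝ, 0 < c ∧ ∀ (S : Set ℤ) (n : ℕ) (a b : ℤ), 1 ≤ n →
      (∀ x : ℤ, a ≤ x → x + 1 < a + 2 * n → x ∈ S) → c ≤ (νmix S).real (lrCross a b (2 * n) n) := by
  obtain ⟨c, hc, h⟩ :=
    pureIK_of_transport stub_bridge stub_patternLocality stub_quarterTurn stub_freeLocality verticalClause
  refine ⟨c, hc, fun S n a b hn hS => ?_⟩
  rw [nuMix_real_lrCross, pLR_two_mul_eq_pH, (stub_bridge S n a b).1]
  exact (h S n a b hn).1 hS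

/-! ## Appended (lead c6, second proposal): the full bottom–top clause at aspect bound 2 -/

/-- WIDTH, the easy direction for bottom–top crossings: a black BT crossing of the `w × h` box at `(a,b)` is a black BT
crossing of every wider box `w' × h` at `(a,b)`, `w ≤ w'` (monotonicity of `openCrossing` in the ambient set and the two
target sets). [folklore] -/
theorem tbCross_subset_of_width_le {a b : ℤ} {w w' h : ℕ} (hww' : w ≤ w') :
    tbCross a b w h ⊆ tbCross a b w' h := by
  intro x hx
  simp only [tbCross, Set.mem_setOf_eq] at hx ⊢
  have hZ : (w : ℤ) ≤ w' := by exact_mod_cast hww'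
  refine Literature.Probability.Percolation.openCrossing_mono ?_ ?_ ?_ hx
  · intro v hv; simp only [Set.mem_setOf_eq] at hv ⊢; omega
  · intro v hv; simp only [Set.mem_setOf_eq] at hv ⊢; omega
  · intro v hv; simp only [Set.mem_setOf_eq] at hv ⊢; omega

/-- **THE FULL BOTTOM–TOP CLAUSE OF `IKFarRSW` AT ASPECT BOUND `k = 2`** (registered sub-goal `ikFarRSW_tbCross_le_two`):
there is `c > 0` such that for every column pattern `S`, every `n ≥ 1`, every position and every `w × h` box with `n ≤ w` and
`n ≤ h ≤ 2n`, the box is crossed bottom-to-top by a black path with `ν_S`-probability at least `c` — from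
`ikFarRSW_tbCross_two` by antitonicity in the height (`MonotoneStub.tbCross_subset`, the sister line's first-hitting-level
argument) and monotonicity in the width (`tbCross_subset_of_width_le`). This is exactly the second conjunct of
`FarRSWBound c S n a b w h univ` for `k = 2`; heights `h > 2n` (aspect bounds `k > 2`) need vertical GLUING and stay open. -/
theorem ikFarRSW_tbCross_le_two :
    ∃ c : ℝ, 0 < c ∧ ∀ (S : Set ℤ) (n : ℕ) (a b : ℤ) (w h : ℕ), 1 ≤ n → n ≤ w → n ≤ h → h ≤ 2 * n →
      c ≤ (νmix S).real (tbCross a b w h) := by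
  obtain ⟨c, hc, hV⟩ := ikFarRSW_tbCross_two
  refine ⟨c, hc, fun S n a b w h hn hnw _ hh2 => ?_⟩
  haveI : IsProbabilityMeasure (νmix S) := isProbabilityMeasure_nuMix S
  have h1 : c ≤ (νmix S).real (tbCross a b n (2 * n)) := hV S n a b hn
  have h2 : (νmix S).real (tbCross a b n (2 * n)) ≤ (νmix S).real (tbCross a b n h) :=
    measureReal_mono (MonotoneStub.tbCross_subset (by omega) hh2)
  have h3 : (νmix S).real (tbCross a b n h) ≤ (νmix S).real (tbCross a b w h) :=
    measureReal_mono (tbCross_subset_of_width_le hnw)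
  linarith

/-! ## Appended (lead c6, third proposal): the left–right clause at aspect bound 2 on isotropic boxes -/

/-- HEIGHT, the easy direction for left–right crossings: a black LR crossing of the `w × h` box at `(a,b)` is a black LR
crossing of every taller box `w × h'` at `(a,b)`, `h ≤ h'`. [folklore] -/
theorem lrCross_subset_of_height_le {a b : ℤ} {w h h' : ℕ} (hhh' : h ≤ h') :
    lrCross a b w h ⊆ lrCross a b w h' := by
  intro x hx
  simp only [lrCross, Set.mem_setOf_eq] at hx ⊢
  have hZ : (h : ℤ) ≤ h' := by exact_mod_cast hhh'
  refine Literature.Probability.Percolation.openCrossing_mono ?_ ?_ ?_ hx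
  · intro v hv; simp only [Set.mem_setOf_eq] at hv ⊢; omega
  · intro v hv; simp only [Set.mem_setOf_eq] at hv ⊢; omega
  · intro v hv; simp only [Set.mem_setOf_eq] at hv ⊢; omega

/-- **THE LEFT–RIGHT CLAUSE OF `IKFarRSW` AT ASPECT BOUND `k = 2` ON ISOTROPIC BOXES** (registered sub-goal
`ikFarRSW_lrCross_le_two_iso`): there is `c > 0` such that for every column pattern `S`, every `n ≥ 1`, every position whose
`2n`-wide box has isotropic interior face columns, and every `w × h` with `n ≤ w ≤ 2n`, `n ≤ h`, the `w × h` box is crossed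
left-to-right by a black path with `ν_S`-probability at least `c` — from `ikFarRSW_lrCross_two_iso` by antitonicity in the width
(`MonotoneStub.lrCross_subset`) and monotonicity in the height (`lrCross_subset_of_height_le`). Together with
`ikFarRSW_tbCross_le_two` this is everything of `IKFarRSW` at `k = 2` that the sister line's landed transport yields; the mixed-box
horizontal clause (stmt-5911 `stub_csmColIneq`), `k > 2` and the rings remain. -/
theorem ikFarRSW_lrCross_le_two_iso :
    ∃ c : ℝ, 0 < c ∧ ∀ (S : Set ℤ) (n : ℕ) (a b : ℤ) (w h : ℕ), 1 ≤ n → n ≤ w → w ≤ 2 * n → n ≤ h →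
      (∀ x : ℤ, a ≤ x → x + 1 < a + 2 * n → x ∈ S) → c ≤ (νmix S).real (lrCross a b w h) := by
  obtain ⟨c, hc, hL⟩ := ikFarRSW_lrCross_two_iso
  refine ⟨c, hc, fun S n a b w h hn _ hw2 hnh hS => ?_⟩
  haveI : IsProbabilityMeasure (νmix S) := isProbabilityMeasure_nuMix S
  have h1 : c ≤ (νmix S).real (lrCross a b (2 * n) n) := hL S n a b hn hS
  have h2 : (νmix S).real (lrCross a b (2 * n) n) ≤ (νmix S).real (lrCross a b w n) :=
    measureReal_mono (MonotoneStub.lrCross_subset (by omega) hw2)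
  have h3 : (νmix S).real (lrCross a b w n) ≤ (νmix S).real (lrCross a b w h) :=
    measureReal_mono (lrCross_subset_of_height_le hnh)
  linarith

end Summit.CriticalPhenomena.CardyFormulaZ2.Theorems.IKLinearTransport.PinnedDiagramExchange.FarRSWFragments

end
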